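import Mathlib
import Summits.NavierStokesRegularity.NavierStokesRegularity.Theorems.EulerZoomLiouvillePowerGaugeEulerLiouvilleMirrorMomentTransport
import Summits.NavierStokesRegularity.NavierStokesRegularity.Theorems.EulerZoomLiouvillePowerGaugeEulerLiouvilleMirrorMomentAxialFlux
import Summits.NavierStokesRegularity.NavierStokesRegularity.Theorems.EulerZoomLiouvillePowerGaugeEulerLiouvilleSwirlfreeLedgerConfinement
import Literature.Analysis.FluidPDE.AxisymBiotSavartRadialBound
import Literature.Analysis.FluidPDE.AxisymVorticityAlgebra
import Literature.Analysis.FluidPDE.AxisymWeights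
import HarnessLib

/-!
# Crux `EulerZoomLiouville.PowerGaugeEulerLiouville` (stmt-NavierStokesRegularity-19832), line `mirror-moment`, stub M1 — time side, part 2:
# THE AXIAL LEDGER MOMENT IS NON-DECREASING (limit `R → ∞`, slice dictionary, assembly on `(−∞, 0)`)

Route №10 `EulerZoomLiouville` (NavierStokesRegularity), crux E, line `mirror-moment`, registered stub `stub_momentMonotone` (M1):
`IsMirrorOutgoingWith u p R₀ β → MomentMonotone u`.  Seat ns-sfl-p1 g3 (LEAD ns-typeII-p2 g10 KEY 2026-08-28 09:38Z).  Continuing part 1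
(`…MirrorMomentTransport`: cut-off balance of `∫ χ_R x₃ Ω`):

* `integral_axial_mul_angVortQuot_mono_of_sliceSign` — on a slab `[0,T]` with speed bound `‖v‖ ≤ B`, weighted ledger bound
  `∫ (1+‖x‖)|Ω(σ)| ≤ K` and the SLICE SIGN `0 ≤ ∫ v₃ Ω(σ)`: `∫ x₃ Ω(s) ≤ ∫ x₃ Ω(t)` for `s ≤ t`
  (the cut-off errors are `≤ BK(C/R + 1/(1+R))` uniformly on the slab; `R → ∞` by `tendsto_integral_cutoff_mul`);
* `axisLedger_dictionary` — off the axis `‖curl v‖/r = |Ω|`, `|x₃|·‖curl v‖/r = x₃ Ω` (outgoing sign), `swirl (curl v)/r² = Ω`;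
* `momentMonotone_of_mirrorOutgoingWith_of_ledgerBound` — **THE TIME SIDE OF M1**: the line's `IsMirrorOutgoingWith u p R₀ β` (written out
  as in `MirrorMoment.blobsPersist_of_mirrorOutgoingWith`) PLUS one clause `hN` (the weighted ledger moment `∫(1+‖x‖)η` LOCALLY BOUNDED IN
  TIME — the registered predicate asks it slice by slice only) ⇒ the line's `MomentMonotone u` (written out); the slice sign is ns-ezl-w2 g2's
  `MirrorMoment.integral_axialFlux_nonneg` (Choi–Jeong's identity `∫ u_z ω_θ/r = ∫ u_r²/r² + π∫_{axis} u_z² ≥ 0`, Cartesian form).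
The clause `hN` holds in truth (transport + speed bound: mass moves at speed `≤ B`); its Eulerian derivation by moving cut-off weights is
the planned follow-up, after which the registered signature is met verbatim.
WHAT THIS IS NOT: not NS, not the crux E — helper `--supports` stmt-19832 for ONE stratum lemma; 19832 OPEN.
[cite: MajdaBertozziCUP2002, §2.3.3 (2.58)–(2.59); cf. Choi–Jeong, arXiv:2110.09079, Lemma 3.3 (compact support, forward orientation)]
-/

noncomputable section

-- flat `Theorems/<Route><Decl>…` files of one crux share the namespace of the crux (tree convention)
set_option linter.dupNamespace false

open MeasureTheory Set Filter Topology Metric Function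
open scoped NNReal ENNReal RealInnerProductSpace

namespace Summit.NavierStokesRegularity.NavierStokesRegularity.Theorems.PowerGaugeEulerLiouville.MirrorMoment

open Literature.Analysis Literature.Analysis.FluidPDE
open Summit.NavierStokesRegularity.NavierStokesRegularity.Theorems.PowerGaugeEulerLiouville.AxisymNoSwirl

/-! ### The limit `R → ∞` under slab bounds and the slice sign -/

/-- **Monotonicity of the axial functional `∫ x₃ Ω` on a slab, given the slice sign.**  Let `v` be a classical swirl-free axisymmetric Euler
flow on `[0, T]` with `Ω = angVortQuot (v ·)`; assume on the slab the speed bound `‖v‖ ≤ B`, the weighted ledger bound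
`∫ (1 + ‖x‖) |Ω(σ,x)| dx ≤ K` (integrable) and the SLICE SIGN `0 ≤ ∫ v₃ Ω(σ)` for every `σ ∈ [0, T]`.  Then for `0 ≤ s ≤ t ≤ T`:
`∫ x₃ Ω(s,x) dx ≤ ∫ x₃ Ω(t,x) dx`.  Proof: the cut-off balance with `χ_{n+1}`; on every slice
`∫ Ω (χ v₃ + x₃ Dχ[v]) ≥ −BK(1/(n+2) + C/(n+1))` (tail of the ledger beyond radius `n+1`, gradient bound `‖Dχ_R‖ ≤ C/R`); `n → ∞`
by dominated convergence (`tendsto_integral_cutoff_mul`). [folklore] -/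
theorem integral_axial_mul_angVortQuot_mono_of_sliceSign {T : ℝ} (hT : 0 < T)
    {v : ℝ → EuclideanSpace ℝ (Fin 3) → EuclideanSpace ℝ (Fin 3)} {q : ℝ → EuclideanSpace ℝ (Fin 3) → ℝ}
    (hv : IsClassicalNSSolutionOn (Icc 0 T) 0 0 v q)
    (hax : ∀ σ ∈ Icc 0 T, IsAxisymmetric (v σ)) (hsw : ∀ σ ∈ Icc 0 T, HasNoSwirl (v σ))
    {B K : ℝ} (hB : ∀ σ ∈ Icc 0 T, ∀ y, ‖v σ y‖ ≤ B)
    (hK : ∀ σ ∈ Icc 0 T, Integrable (fun x => (1 + ‖x‖) * |angVortQuot (v σ) x|) ∧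
      ∫ x, (1 + ‖x‖) * |angVortQuot (v σ) x| ≤ K)
    (hsign : ∀ σ ∈ Icc 0 T, 0 ≤ ∫ x, v σ x 2 * angVortQuot (v σ) x)
    {s t : ℝ} (hs : 0 ≤ s) (hst : s ≤ t) (ht : t ≤ T) :
    ∫ x, x 2 * angVortQuot (v s) x ≤ ∫ x, x 2 * angVortQuot (v t) x := by
  obtain ⟨C, hC0, hC⟩ := exists_norm_fderiv_cutoff_le (E := EuclideanSpace ℝ (Fin 3))
  have hB0 : 0 ≤ B := (norm_nonneg _).trans (hB 0 ⟨le_rfl, hT.le⟩ 0)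
  have hK0 : 0 ≤ K := le_trans (integral_nonneg fun x => by positivity) (hK 0 ⟨le_rfl, hT.le⟩).2
  have hU : UniqueDiffOn ℝ (Icc 0 T) := uniqueDiffOn_Icc hT
  have hWfam : IsSmoothSpaceTimeOn (Icc 0 T) (fun σ => angVortQuot (v σ)) :=
    hv.smooth_velocity.angVortQuot_family (convex_Icc 0 T) hU
  -- pointwise bounds on a slice
  have hx2 : ∀ x : EuclideanSpace ℝ (Fin 3), |x 2| ≤ ‖x‖ := fun x => by
    have h := PiLp.norm_apply_le x 2
    rwa [Real.norm_eq_abs] at h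
  -- integrability of `x₃ Ω(σ)` and `v₃ Ω(σ)` on the slab
  have hintax : ∀ σ ∈ Icc 0 T, Integrable (fun x : EuclideanSpace ℝ (Fin 3) => x 2 * angVortQuot (v σ) x) := by
    intro σ hσ
    have hc : Continuous fun x : EuclideanSpace ℝ (Fin 3) => x 2 * angVortQuot (v σ) x :=
      (EuclideanSpace.proj (𝕜 := ℝ) (2 : Fin 3)).continuous.mul (hWfam.contDiff_slice hσ).continuous
    refine (hK σ hσ).1.mono hc.aestronglyMeasurable (Eventually.of_forall fun x => ?_)
    rw [Real.norm_eq_abs, Real.norm_eq_abs, abs_mul, abs_of_nonneg (by positivity : 0 ≤ (1 + ‖x‖) * |angVortQuot (v σ) x|)]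
    gcongr
    linarith [hx2 x, norm_nonneg x]
  -- the slice lower bound for the cut-off flux
  have hslice : ∀ n : ℕ, ∀ σ ∈ Icc 0 T,
      -(B * K * (1 / ((n : ℝ) + 2) + C / ((n : ℝ) + 1))) ≤
        ∫ x, angVortQuot (v σ) x * (cutoff ((n : ℝ) + 1) x * v σ x 2 + x 2 * fderiv ℝ (cutoff ((n : ℝ) + 1)) x (v σ x)) := by
    intro n σ hσ
    set R : ℝ := (n : ℝ) + 1 with hRdef
    have hR : 0 < R := by positivity
    set W : EuclideanSpace ℝ (Fin 3) → ℝ := angVortQuot (v σ) with hWdef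
    have hWc : Continuous W := (hWfam.contDiff_slice hσ).continuous
    have hvc : Continuous (v σ) := (hv.contDiff_velocity hσ).continuous
    have hχc : Continuous (cutoff (E := EuclideanSpace ℝ (Fin 3)) R) := (contDiff_cutoff (n := 0) R).continuous
    have hDχc : Continuous (fderiv ℝ (cutoff (E := EuclideanSpace ℝ (Fin 3)) R)) := (contDiff_cutoff (n := 1) R).continuous_fderiv one_ne_zero
    obtain ⟨hKi, hKle⟩ := hK σ hσ
    -- the two pieces and their integrability
    have hmeas1 : AEStronglyMeasurable (fun x => W x * (cutoff R x * v σ x 2)) volume :=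
      (hWc.mul (hχc.mul ((EuclideanSpace.proj (𝕜 := ℝ) (2 : Fin 3)).continuous.comp hvc))).aestronglyMeasurable
    have hmeas2 : AEStronglyMeasurable (fun x => W x * (x 2 * fderiv ℝ (cutoff R) x (v σ x))) volume :=
      (hWc.mul ((EuclideanSpace.proj (𝕜 := ℝ) (2 : Fin 3)).continuous.mul (hDχc.clm_apply hvc))).aestronglyMeasurable
    have hb1 : ∀ x, ‖W x * (cutoff R x * v σ x 2)‖ ≤ B * ((1 + ‖x‖) * |W x|) := by
      intro x
      rw [Real.norm_eq_abs, abs_mul, abs_mul]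
      have h1 : |cutoff R x| ≤ 1 := abs_cutoff_le_one R x
      have h2 : |v σ x 2| ≤ B := (hx2 (v σ x)).trans (hB σ hσ x)
      have h3 : |W x| ≤ (1 + ‖x‖) * |W x| := le_mul_of_one_le_left (abs_nonneg _) (by linarith [norm_nonneg x])
      calc |W x| * (|cutoff R x| * |v σ x 2|) ≤ ((1 + ‖x‖) * |W x|) * (1 * B) := by gcongr
        _ = B * ((1 + ‖x‖) * |W x|) := by ring
    have hb2 : ∀ x, ‖W x * (x 2 * fderiv ℝ (cutoff R) x (v σ x))‖ ≤ C / R * B * ((1 + ‖x‖) * |W x|) := by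
      intro x
      rw [Real.norm_eq_abs, abs_mul, abs_mul]
      have h1 : |fderiv ℝ (cutoff R) x (v σ x)| ≤ C / R * B := by
        calc |fderiv ℝ (cutoff R) x (v σ x)| = ‖fderiv ℝ (cutoff R) x (v σ x)‖ := (Real.norm_eq_abs _).symm
          _ ≤ ‖fderiv ℝ (cutoff R) x‖ * ‖v σ x‖ := ContinuousLinearMap.le_opNorm _ _
          _ ≤ C / R * B := mul_le_mul (hC R hR x) (hB σ hσ x) (norm_nonneg _) ((norm_nonneg _).trans (hC R hR 0))
      have h2 : |x 2| ≤ 1 + ‖x‖ := by linarith [hx2 x, norm_nonneg x]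
      calc |W x| * (|x 2| * |fderiv ℝ (cutoff R) x (v σ x)|) ≤ |W x| * ((1 + ‖x‖) * (C / R * B)) := by
            gcongr
        _ = C / R * B * ((1 + ‖x‖) * |W x|) := by ring
    have hi1 : Integrable fun x => W x * (cutoff R x * v σ x 2) :=
      (hKi.const_mul B).mono' hmeas1 (Eventually.of_forall hb1)
    have hi2 : Integrable fun x => W x * (x 2 * fderiv ℝ (cutoff R) x (v σ x)) :=
      (hKi.const_mul (C / R * B)).mono' hmeas2 (Eventually.of_forall hb2)
    -- piece 2: `|∫ W x₃ Dχ[v]| ≤ (C/R) B K`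
    have hp2 : -(C / R * B * K) ≤ ∫ x, W x * (x 2 * fderiv ℝ (cutoff R) x (v σ x)) := by
      have h := norm_integral_le_of_norm_le (hKi.const_mul (C / R * B)) (Eventually.of_forall hb2)
      rw [integral_const_mul, Real.norm_eq_abs] at h
      have h' : |∫ x, W x * (x 2 * fderiv ℝ (cutoff R) x (v σ x))| ≤ C / R * B * K :=
        h.trans (mul_le_mul_of_nonneg_left hKle (by positivity))
      linarith [neg_abs_le (∫ x, W x * (x 2 * fderiv ℝ (cutoff R) x (v σ x)))]
    -- piece 1: `∫ W χ v₃ ≥ ∫ W v₃ − B K/(R+1) ≥ −B K/(R+1)`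
    have hvW : Integrable fun x => v σ x 2 * W x := by
      refine (hKi.const_mul B).mono' (((EuclideanSpace.proj (𝕜 := ℝ) (2 : Fin 3)).continuous.comp hvc).mul hWc).aestronglyMeasurable
        (Eventually.of_forall fun x => ?_)
      rw [Real.norm_eq_abs, abs_mul]
      have h2 : |v σ x 2| ≤ B := (hx2 (v σ x)).trans (hB σ hσ x)
      have h3 : |W x| ≤ (1 + ‖x‖) * |W x| := le_mul_of_one_le_left (abs_nonneg _) (by linarith [norm_nonneg x])
      calc |v σ x 2| * |W x| ≤ B * ((1 + ‖x‖) * |W x|) := by gcongr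
        _ = B * ((1 + ‖x‖) * |W x|) := rfl
    have htail : ∀ x, ‖v σ x 2 * W x - W x * (cutoff R x * v σ x 2)‖ ≤ B / (R + 1) * ((1 + ‖x‖) * |W x|) := by
      intro x
      have e : v σ x 2 * W x - W x * (cutoff R x * v σ x 2) = (1 - cutoff R x) * (v σ x 2 * W x) := by ring
      rw [e, Real.norm_eq_abs, abs_mul, abs_mul]
      by_cases hxR : ‖x‖ ≤ R
      · rw [cutoff_eq_one hR hxR, sub_self, abs_zero, zero_mul]
        positivity
      · have hxR' : R < ‖x‖ := not_le.1 hxR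
        have h1 : |1 - cutoff R x| ≤ 1 := by
          rw [abs_of_nonneg (by linarith [cutoff_le_one R x])]
          linarith [cutoff_nonneg R x]
        have h2 : |v σ x 2| ≤ B := (hx2 (v σ x)).trans (hB σ hσ x)
        have h3 : (1 : ℝ) ≤ (1 + ‖x‖) / (R + 1) := by rw [le_div_iff₀ (by positivity)]; linarith
        calc |1 - cutoff R x| * (|v σ x 2| * |W x|) ≤ 1 * (B * |W x|) := by gcongr
          _ = B * |W x| * 1 := by ring
          _ ≤ B * |W x| * ((1 + ‖x‖) / (R + 1)) := by gcongr
          _ = B / (R + 1) * ((1 + ‖x‖) * |W x|) := by ring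
    have hp1 : -(B / (R + 1) * K) ≤ ∫ x, W x * (cutoff R x * v σ x 2) := by
      have h := norm_integral_le_of_norm_le (hKi.const_mul (B / (R + 1))) (Eventually.of_forall htail)
      rw [integral_sub hvW hi1, integral_const_mul, Real.norm_eq_abs] at h
      have h' : |(∫ x, v σ x 2 * W x) - ∫ x, W x * (cutoff R x * v σ x 2)| ≤ B / (R + 1) * K :=
        h.trans (mul_le_mul_of_nonneg_left hKle (by positivity))
      have hs0 := hsign σ hσ
      have := (abs_le.1 h').2
      linarith
    rw [show (fun x => W x * (cutoff R x * v σ x 2 + x 2 * fderiv ℝ (cutoff R) x (v σ x))) =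
        fun x => W x * (cutoff R x * v σ x 2) + W x * (x 2 * fderiv ℝ (cutoff R) x (v σ x)) from funext fun x => by ring,
      integral_add hi1 hi2]
    have eR : R + 1 = (n : ℝ) + 2 := by rw [hRdef]; ring
    rw [eR] at hp1
    have : B * K * (1 / ((n : ℝ) + 2) + C / R) = B / ((n : ℝ) + 2) * K + C / R * B * K := by ring
    linarith
  -- the cut-off balance integrated: `∫χx₃Ω(t) − ∫χx₃Ω(s) ≥ −(t − s)·e_n`
  have hbal : ∀ n : ℕ, -((t - s) * (B * K * (1 / ((n : ℝ) + 2) + C / ((n : ℝ) + 1)))) ≤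
      (∫ x, cutoff ((n : ℝ) + 1) x * x 2 * angVortQuot (v t) x) - ∫ x, cutoff ((n : ℝ) + 1) x * x 2 * angVortQuot (v s) x := by
    intro n
    have hR : (0 : ℝ) < (n : ℝ) + 1 := by positivity
    rw [axialMoment_balance_cutoff hT hv hax hsw hs hst ht hR]
    have h := setIntegral_mono_on (μ := volume) (s := Ioo s t)
      (f := fun _ => -(B * K * (1 / ((n : ℝ) + 2) + C / ((n : ℝ) + 1))))
      (g := fun τ => ∫ x, angVortQuot (v τ) x * (cutoff ((n : ℝ) + 1) x * v τ x 2 + x 2 * fderiv ℝ (cutoff ((n : ℝ) + 1)) x (v τ x)))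
      ((continuousOn_const.integrableOn_compact isCompact_Icc).mono_set Ioo_subset_Icc_self) ?_ measurableSet_Ioo
      (fun τ hτ => hslice n τ ⟨hs.trans hτ.1.le, hτ.2.le.trans ht⟩)
    · rw [setIntegral_const, Real.volume_real_Ioo_of_le hst, smul_eq_mul] at h
      linarith
    -- integrability of the flux in time: it is the continuous function `τ ↦ ∫ φ ∂ₜΩ(τ)`
    have hχ : ContDiff ℝ 1 (cutoff (E := EuclideanSpace ℝ (Fin 3)) ((n : ℝ) + 1)) := contDiff_cutoff _
    have hχc : HasCompactSupport (cutoff (E := EuclideanSpace ℝ (Fin 3)) ((n : ℝ) + 1)) := hasCompactSupport_cutoff hR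
    have hcoord : ContDiff ℝ 1 (fun y : EuclideanSpace ℝ (Fin 3) => y 2) := (EuclideanSpace.proj (𝕜 := ℝ) (2 : Fin 3)).contDiff
    have hφ1 : ContDiff ℝ 1 (fun x : EuclideanSpace ℝ (Fin 3) => cutoff ((n : ℝ) + 1) x * x 2) := hχ.mul hcoord
    have hφc : HasCompactSupport (fun x : EuclideanSpace ℝ (Fin 3) => cutoff ((n : ℝ) + 1) x * x 2) := hχc.mul_right
    have hcont : ContinuousOn (fun τ => ∫ x, (cutoff ((n : ℝ) + 1) x * x 2) *
        FluidPDE.timeDerivWithin (Icc 0 T) (fun σ => angVortQuot (v σ)) τ x) (Icc s t) :=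
      (continuousOn_integral_mul_of_continuousOn hφ1.continuous hφc ((hWfam.timeDerivWithin hU).continuousOn)).mono
        (Icc_subset_Icc hs ht)
    refine ((hcont.integrableOn_compact isCompact_Icc).mono_set Ioo_subset_Icc_self).congr_fun (fun τ hτ => ?_) measurableSet_Ioo
    have hτ' : τ ∈ Icc 0 T := ⟨hs.trans hτ.1.le, hτ.2.le.trans ht⟩
    have key := integral_weight_mul_timeDerivWithin_angVortQuot hT hv hax hsw hτ' hφ1 hφc
    beta_reduce at key
    beta_reduce
    rw [key]
    refine integral_congr_ae (Eventually.of_forall fun x => ?_)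
    have hd : HasFDerivAt (fun x : EuclideanSpace ℝ (Fin 3) => cutoff ((n : ℝ) + 1) x * x 2)
        (cutoff ((n : ℝ) + 1) x • EuclideanSpace.proj (𝕜 := ℝ) (2 : Fin 3) + (x 2) • fderiv ℝ (cutoff ((n : ℝ) + 1)) x) x :=
      ((hχ.differentiable one_ne_zero x).hasFDerivAt).mul (hasFDerivAt_coord_two x)
    show angVortQuot (v τ) x * fderiv ℝ (fun x : EuclideanSpace ℝ (Fin 3) => cutoff ((n : ℝ) + 1) x * x 2) x (v τ x) =
      angVortQuot (v τ) x * (cutoff ((n : ℝ) + 1) x * v τ x 2 + x 2 * fderiv ℝ (cutoff ((n : ℝ) + 1)) x (v τ x))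
    rw [hd.fderiv]
    simp only [FunLike.coe_add, FunLike.coe_smul, Pi.add_apply, Pi.smul_apply, smul_eq_mul]
    rfl
  -- the limits
  have hlt := tendsto_integral_cutoff_mul (hintax t ⟨hs.trans hst, ht⟩)
  have hls := tendsto_integral_cutoff_mul (hintax s ⟨hs, hst.trans ht⟩)
  have hlim : Tendsto (fun n : ℕ => (∫ x, cutoff ((n : ℝ) + 1) x * x 2 * angVortQuot (v t) x) -
      ∫ x, cutoff ((n : ℝ) + 1) x * x 2 * angVortQuot (v s) x) atTop
      (𝓝 ((∫ x, x 2 * angVortQuot (v t) x) - ∫ x, x 2 * angVortQuot (v s) x)) := by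
    have e : ∀ (n : ℕ) (τ : ℝ), (∫ x, cutoff ((n : ℝ) + 1) x * x 2 * angVortQuot (v τ) x) =
        ∫ x, cutoff ((n : ℝ) + 1) x * (x 2 * angVortQuot (v τ) x) := fun n τ =>
      integral_congr_ae (Eventually.of_forall fun x => by ring)
    simp_rw [e]
    exact hlt.sub hls
  have herr : Tendsto (fun n : ℕ => -((t - s) * (B * K * (1 / ((n : ℝ) + 2) + C / ((n : ℝ) + 1))))) atTop (𝓝 0) := by
    have h1 : Tendsto (fun n : ℕ => C / ((n : ℝ) + 1)) atTop (𝓝 0) :=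
      tendsto_const_nhds.div_atTop (tendsto_natCast_atTop_atTop.atTop_add tendsto_const_nhds)
    have h2 : Tendsto (fun n : ℕ => 1 / ((n : ℝ) + 2)) atTop (𝓝 0) :=
      tendsto_const_nhds.div_atTop (tendsto_natCast_atTop_atTop.atTop_add tendsto_const_nhds)
    have := (((h2.add h1).const_mul (B * K)).const_mul (t - s)).neg
    simpa using this
  have := le_of_tendsto_of_tendsto herr hlim (Eventually.of_forall hbal)
  linarith


/-! ### The slice dictionary: `|x₃| η = x₃ Ω`, `|Ω| = η`, and the slice sign -/

/-- The symmetry axis of `ℝ³` is Lebesgue-null: `cylRadius x ≠ 0` for a.e. `x`. [folklore] -/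
theorem ae_cylRadius_ne_zero : ∀ᵐ x : EuclideanSpace ℝ (Fin 3) ∂volume, cylRadius x ≠ 0 := by
  have h := volume_axis_eq_zero
  rw [ae_iff]
  refine measure_mono_null (fun x hx => ?_) h
  have hx' : cylRadius x = 0 := by simpa using hx
  have := (cylRadius_eq_zero_iff x).1 hx'
  show x 0 ^ 2 + x 1 ^ 2 = 0
  rw [this.1, this.2]; ring

/-- **Slice dictionary** for an axisymmetric swirl-free smooth field with the OUTGOING sign `x₃ · swirl (curl v) ≥ 0`: off the axis,
`‖curl v x‖ / r = |Ω x|` and `|x₃| · ‖curl v x‖/r = x₃ Ω x` with `Ω = angVortQuot v = ω_θ/r`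
(`curl v = Ω · J`, `‖Jx‖ = r`, `swirl (curl v) = r² Ω`). [folklore] -/
theorem axisLedger_dictionary {v : EuclideanSpace ℝ (Fin 3) → EuclideanSpace ℝ (Fin 3)} (hv : ContDiff ℝ 3 v)
    (hax : IsAxisymmetric v) (hsw : HasNoSwirl v) (hout : ∀ x : EuclideanSpace ℝ (Fin 3), 0 ≤ x 2 * swirl (curl v) x)
    {x : EuclideanSpace ℝ (Fin 3)} (hx : cylRadius x ≠ 0) :
    ‖curl v x‖ / cylRadius x = |angVortQuot v x| ∧ |x 2| * (‖curl v x‖ / cylRadius x) = x 2 * angVortQuot v x ∧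
      swirl (curl v) x / cylRadius x ^ 2 = angVortQuot v x := by
  have hr2 : 0 < cylRadius x ^ 2 := by positivity
  have hΩ : cylRadius x ^ 2 * angVortQuot v x = swirl (curl v) x := hax.cylRadius_sq_mul_angVortQuot hv x
  have hquot : swirl (curl v) x / cylRadius x ^ 2 = angVortQuot v x := by
    rw [← hΩ]; field_simp
  have h1 : ‖curl v x‖ / cylRadius x = |angVortQuot v x| := by
    rw [Summit.NavierStokesRegularity.NavierStokesRegularity.Theorems.PowerGaugeEulerLiouville.SwirlfreeLedger.div_cylRadius_eq_abs_omegaTilde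
      hax hsw (hv.of_le (by norm_num)) hx, ← div_eq_mul_inv, hquot]
  refine ⟨h1, ?_, hquot⟩
  rw [h1]
  have hsign : 0 ≤ x 2 * angVortQuot v x := by
    have h := hout x
    rw [← hΩ, show x 2 * (cylRadius x ^ 2 * angVortQuot v x) = cylRadius x ^ 2 * (x 2 * angVortQuot v x) by ring] at h
    exact (mul_nonneg_iff_of_pos_left hr2).1 h
  rw [← abs_mul, abs_of_nonneg hsign]

/-- **THE TIME SIDE OF M1 `stub_momentMonotone` (line `mirror-moment`).**  For a classical mirror-outgoing member — the line's predicate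
`IsMirrorOutgoingWith u p R₀ β` written out as in `MirrorMoment.blobsPersist_of_mirrorOutgoingWith` — which moreover has its weighted ledger
moment LOCALLY BOUNDED IN TIME (`hN`: on every compact past slab `∫ (1+‖x‖) η(τ,x) dx ≤ K`; the predicate itself only asks finiteness slice by
slice), the axial ledger moment `M(τ) = ∫ |x₃| η(τ,x) dx` is non-decreasing on `τ < 0` (the line's `MomentMonotone u`, written out).
Proof: time shift to `[0, T]`; `|x₃| η = x₃ Ω` (outgoing sign); `integral_axial_mul_angVortQuot_mono_of_sliceSign` with the slab speed
bound of the predicate, `hN`, and the SLICE SIGN `0 ≤ ∫ u₃ Ω` = ns-ezl-w2 g2's `MirrorMoment.integral_axialFlux_nonneg` (Choi–Jeong's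
identity).  The clause `hN` is the one addition to the registered signature (flagged `stub-misstated` to the LEAD: it holds in truth by transport
and the speed bound, but is not derivable slice by slice). [cite: MajdaBertozziCUP2002, §2.3.3 (2.58)–(2.59); cf. Choi–Jeong arXiv:2110.09079 L3.3] -/
theorem momentMonotone_of_mirrorOutgoingWith_of_ledgerBound
    (u : ℝ → EuclideanSpace ℝ (Fin 3) → EuclideanSpace ℝ (Fin 3)) (p : ℝ → EuclideanSpace ℝ (Fin 3) → ℝ) (R₀ β : ℝ)
    (h : IsClassicalEulerSolutionOn (Set.Iio 0) 0 u p ∧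
        (∀ τ : ℝ, τ < 0 → IsAxisymmetric (u τ) ∧ HasNoSwirl (u τ)) ∧
        (∀ τ : ℝ, τ < 0 → ∀ x : EuclideanSpace ℝ (Fin 3),
          u τ (x - (2 * x 2) • (eZ : EuclideanSpace ℝ (Fin 3))) = u τ x - (2 * u τ x 2) • (eZ : EuclideanSpace ℝ (Fin 3))) ∧
        (∀ τ : ℝ, τ < 0 → ∀ x : EuclideanSpace ℝ (Fin 3), 0 ≤ x 2 * swirl (curl (u τ)) x) ∧
        0 ≤ R₀ ∧ 0 ≤ β ∧
        (∀ τ : ℝ, τ < 0 → ∀ x : EuclideanSpace ℝ (Fin 3), R₀ * (1 + -τ) ^ β < cylRadius x → curl (u τ) x = 0) ∧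
        (∀ τ : ℝ, τ < 0 →
          Integrable (fun x : EuclideanSpace ℝ (Fin 3) => (1 + ‖x‖) * ‖u τ x‖ ^ 2) ∧
            Integrable (fun x : EuclideanSpace ℝ (Fin 3) => (1 + ‖x‖) * (‖curl (u τ) x‖ / cylRadius x))) ∧
        (∀ T T' : ℝ, T ≤ T' → T' < 0 → ∃ B : ℝ, ∀ τ ∈ Set.Icc T T', ∀ x : EuclideanSpace ℝ (Fin 3), ‖u τ x‖ ≤ B))
    (hN : ∀ T T' : ℝ, T ≤ T' → T' < 0 → ∃ K : ℝ, ∀ τ ∈ Set.Icc T T',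
      ∫ x : EuclideanSpace ℝ (Fin 3), (1 + ‖x‖) * (‖curl (u τ) x‖ / cylRadius x) ≤ K) :
    ∀ τ₁ τ₂ : ℝ, τ₁ ≤ τ₂ → τ₂ < 0 →
      ∫ x : EuclideanSpace ℝ (Fin 3), |x 2| * (‖curl (u τ₁) x‖ / cylRadius x) ≤
        ∫ x : EuclideanSpace ℝ (Fin 3), |x 2| * (‖curl (u τ₂) x‖ / cylRadius x) := by
  intro τ₁ τ₂ h12 hτ₂
  obtain ⟨hcl, hsym, -, hout, -, -, -, hint, hbdd⟩ := h
  rcases h12.eq_or_lt with heq | hlt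
  · rw [heq]
  have hτ₁ : τ₁ < 0 := hlt.trans hτ₂
  -- slice facts on the open past
  have hsm : ∀ τ : ℝ, τ < 0 → ContDiff ℝ 3 (u τ) := fun τ hτ =>
    (hcl.contDiff_velocity (show τ ∈ Set.Iio (0 : ℝ) from hτ)).of_le (by norm_cast)
  have hdict : ∀ τ : ℝ, τ < 0 → ∀ᵐ x : EuclideanSpace ℝ (Fin 3) ∂volume,
      ‖curl (u τ) x‖ / cylRadius x = |angVortQuot (u τ) x| ∧
        |x 2| * (‖curl (u τ) x‖ / cylRadius x) = x 2 * angVortQuot (u τ) x ∧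
        swirl (curl (u τ)) x / cylRadius x ^ 2 = angVortQuot (u τ) x := by
    intro τ hτ
    filter_upwards [ae_cylRadius_ne_zero] with x hx
    exact axisLedger_dictionary (hsm τ hτ) (hsym τ hτ).1 (hsym τ hτ).2 (hout τ hτ) hx
  have hmoment : ∀ τ : ℝ, τ < 0 → ∫ x : EuclideanSpace ℝ (Fin 3), |x 2| * (‖curl (u τ) x‖ / cylRadius x) =
      ∫ x : EuclideanSpace ℝ (Fin 3), x 2 * angVortQuot (u τ) x := fun τ hτ =>
    integral_congr_ae ((hdict τ hτ).mono fun x hx => hx.2.1)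
  rw [hmoment τ₁ hτ₁, hmoment τ₂ hτ₂]
  -- the shifted flow on `[0, T]`
  set T : ℝ := τ₂ - τ₁ with hTdef
  have hT : 0 < T := sub_pos.2 hlt
  have hsub : Icc 0 T ⊆ (fun σ : ℝ => σ + τ₁) ⁻¹' Set.Iio (0 : ℝ) := by
    intro σ hσ
    show σ + τ₁ < 0
    have := hσ.2; rw [hTdef] at this; linarith
  have hmem : ∀ σ ∈ Icc 0 T, σ + τ₁ ∈ Icc τ₁ τ₂ := fun σ hσ =>
    ⟨by linarith [hσ.1], by have := hσ.2; rw [hTdef] at this; linarith⟩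
  have hneg : ∀ σ ∈ Icc 0 T, σ + τ₁ < 0 := fun σ hσ => hsub hσ
  have hv : IsClassicalNSSolutionOn (Icc 0 T) 0 0 (fun σ => u (σ + τ₁)) (fun σ => p (σ + τ₁)) :=
    (hcl.comp_add_right τ₁).mono hsub (uniqueDiffOn_Icc hT)
  obtain ⟨B, hB⟩ := hbdd τ₁ τ₂ hlt.le hτ₂
  obtain ⟨K, hK⟩ := hN τ₁ τ₂ hlt.le hτ₂
  have hmono := integral_axial_mul_angVortQuot_mono_of_sliceSign hT hv
    (fun σ hσ => (hsym _ (hneg σ hσ)).1) (fun σ hσ => (hsym _ (hneg σ hσ)).2) (B := B) (K := K)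
    (fun σ hσ y => hB _ (hmem σ hσ) y) ?_ ?_ (s := 0) (t := T) le_rfl hT.le le_rfl
  · simpa [hTdef] using hmono
  · -- the weighted ledger bound in the `Ω` form
    intro σ hσ
    have hτ : σ + τ₁ < 0 := hneg σ hσ
    have hae := (hdict _ hτ).mono fun x hx => show (1 + ‖x‖) * (‖curl (u (σ + τ₁)) x‖ / cylRadius x) =
        (1 + ‖x‖) * |angVortQuot (u (σ + τ₁)) x| by rw [hx.1]
    refine ⟨((hint _ hτ).2.congr hae), ?_⟩
    rw [← integral_congr_ae hae]
    exact hK _ (hmem σ hσ)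
  · -- the slice sign (ns-ezl-w2 g2's axial flux lemma)
    intro σ hσ
    have hτ : σ + τ₁ < 0 := hneg σ hσ
    have hvs := hcl.contDiff_velocity (show σ + τ₁ ∈ Set.Iio (0 : ℝ) from hτ)
    have hL2 : Integrable fun x : EuclideanSpace ℝ (Fin 3) => ‖u (σ + τ₁) x‖ ^ 2 := by
      refine (hint _ hτ).1.mono (hvs.continuous.norm.pow 2).aestronglyMeasurable (Eventually.of_forall fun x => ?_)
      rw [Real.norm_of_nonneg (by positivity), Real.norm_of_nonneg (by positivity)]
      exact le_mul_of_one_le_left (by positivity) (by linarith [norm_nonneg x])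
    have hη : Integrable fun x : EuclideanSpace ℝ (Fin 3) => ‖curl (u (σ + τ₁)) x‖ / cylRadius x := by
      refine (hint _ hτ).2.mono ?_ (Eventually.of_forall fun x => ?_)
      · exact ((continuous_curl (hvs.of_le (by norm_cast))).norm.measurable.div continuous_cylRadius.measurable).aestronglyMeasurable
      · have h0 : 0 ≤ ‖curl (u (σ + τ₁)) x‖ / cylRadius x := div_nonneg (norm_nonneg _) (cylRadius_nonneg x)
        rw [Real.norm_of_nonneg h0, Real.norm_of_nonneg (mul_nonneg (by positivity) h0)]
        exact le_mul_of_one_le_left h0 (by linarith [norm_nonneg x])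
    have hflux := integral_axialFlux_nonneg (hvs.of_le (by norm_cast)) (hsym _ hτ).1 (hsym _ hτ).2
      (hcl.divFree (σ + τ₁) hτ) (fun x => hB _ (hmem σ hσ) x) hL2 hη
    rw [integral_congr_ae ((hdict _ hτ).mono fun x hx =>
      show u (σ + τ₁) x 2 * (swirl (curl (u (σ + τ₁))) x / cylRadius x ^ 2) = u (σ + τ₁) x 2 * angVortQuot (u (σ + τ₁)) x by
        rw [hx.2.2])] at hflux
    exact hflux

end Summit.NavierStokesRegularity.NavierStokesRegularity.Theorems.PowerGaugeEulerLiouville.MirrorMoment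

end
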